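import Summits.CriticalPhenomena.PercolationContinuityZ3.Theorems.FK.LocalObservableCLT
import Mathlib.Probability.Distributions.Gaussian.Multivariate
import HarnessLib

/-!
# JOINT (MULTIVARIATE) CENTRAL LIMIT THEOREM FOR FINITELY MANY LOCAL OBSERVABLES OF `φ^b_{p,q}` BELOW `p_c(q)`
# (`d ≥ 2`, `q ≥ 1`): THE VECTOR OF NORMALISED BOX SUMS CONVERGES IN DISTRIBUTION TO THE CENTRED GAUSSIAN VECTOR ON `ℝ^κ`
# WITH COVARIANCE MATRIX `Σ_{ij} = Σ_z Cov_{φ^b}(f_i, f_j ∘ T_z)` (CRAMÉR–WOLD THROUGH THE FINITE-DIMENSIONAL LÉVY THEOREM)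

Claimed R42 (8)(c) in the cell INBOX at 2026-08-28T16:10:36Z by fkp-10a gen 354 (NEW CLAIM #4 of the gen), addressed to coordinator fk-4 gen 275 (seated 15:30Z 2026-08-28 by l.8456; rulings in force R151 l.8390, R152 l.8413, R153 l.8422); lineage row FO-10a-g354j (self-suggested), package g354-cltjoint, label JM-A.
Helper file of the `fk-continuity` build cell (bschramm lane; `--supports stmt-CriticalPhenomena-4575`); builds on
p205010 (kernel theorem, internal audit signed; external expert review pending). No definitions, no named facts, no
sorries; standard axioms. UNCONDITIONAL.

For finitely many local observables `f_i = Σ_{a∈A} c_{i,a} 1_{E_a}` (`i ∈ κ`, `κ` a `Fintype`; the events `E_a` determined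
by a finite edge set `F ⊆ E(Λ_k)`; any signs) of the random-cluster measure `φ^b_{p,q} = rcLimit d b p q`,
`0 ≤ p < p_c(q)`, and the lattice translations `T_z ω = ω − z`:

* `tendsto_charFun_localObservable` — the characteristic-function form of the one-dimensional CLT of `LocalObservableCLT`;
* `summable_cov_localObservables`, `cov_linComb_shift_eq`, `dotProduct_localCovMatrix_mulVec_eq` — `z ↦ Cov(f, f' ∘ T_z)` is
  summable, bilinearity along `g_t = Σ_i t_i f_i`, and `t ⬝ Σ t = Σ_z Cov(g_t, g_t ∘ T_z)`;
* `posSemidef_localCovMatrix` — `Σ` is symmetric (translation invariance, `Cov(f_j, f_i∘T_z) = Cov(f_i, f_j∘T_{−z})`) and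
  positive semidefinite (`t ⬝ Σ t = lim_n Var(S_n(g_t))/|Λ_n| ≥ 0`), so `multivariateGaussian 0 Σ` is the honest
  `N(0, Σ)` of Mathlib (`charFun_multivariateGaussian`);
* `tendstoInDistribution_localObservables_joint` — **the joint CLT**: the random vector
  `V_n = |Λ_n|^{-1/2} (S_n(f_i) − E S_n(f_i))_{i∈κ} ∈ EuclideanSpace ℝ κ`, `S_n(f) = Σ_{z∈Λ_n} f ∘ T_z`, converges in
  distribution under `φ^b_{p,q}` to `multivariateGaussian 0 Σ`; proof = Cramér–Wold via Mathlib's finite-dimensional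
  Lévy continuity theorem (`ProbabilityMeasure.tendsto_iff_tendsto_charFun`): `⟨V_n, t⟩` is the normalised box sum of
  the local observable `g_t`, whose characteristic function at `1` tends to `exp(−t ⬝ Σ t/2)`. Nothing is claimed at
  `p_c(q)`; `Σ` may be singular (then `N(0, Σ)` is degenerate, still correctly typed).

## References

* C. M. Newman, *Normal fluctuations and the FKG inequalities*, Comm. Math. Phys. 74 (1980) 119–128, Thm. 2 (joint
  form: hypothesis (D) and the Cramér–Wold device); *A general central limit theorem for FKG systems*, Comm. Math.
  Phys. 91 (1983) 75–80. [Newman1980]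
* G. Grimmett, *The Random-Cluster Model*, Springer 2006, Thm. (4.19)(b) (translation invariance), Cor. (4.23). [Grimmett2006]
* K. S. Alexander, *On weak mixing in lattice models*, PTRF 110 (1998) 441–471, (1.1). [Alexander1998] -/

noncomputable section

namespace Summit.CriticalPhenomena.PercolationContinuityZ3.Theorems.FK

namespace NewmanCLT

open MeasureTheory ProbabilityTheory Complex Finset Filter Topology Matrix
open Literature.Probability.Percolation Literature.Probability.LatticeModels Literature.Barriers.CriticalPhenomena
open BoundaryInfluence
open scoped RealInnerProductSpace

variable {d : ℕ} {p q : ℝ}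

/-- **CLT for a local observable, characteristic-function form**: for `f = Σ_{a∈A} c_a 1_{E_a}` (events `E_a`
determined by `F ⊆ E(Λ_k)`), `0 ≤ p < p_c(q)`, `d ≥ 2`, `q ≥ 1`, both `b`:
`E_{φ^b} exp(is(S_n(f) − E S_n(f))/√|Λ_n|) → exp(−σ²_f s²/2)`, `σ²_f = Σ_z Cov_{φ^b}(f, f ∘ T_z)` (the statement behind
`tendstoInDistribution_localObservable`, needed for Cramér–Wold). [cite: Newman1980, Thm. 2 and the remark after (12); Alexander1998, (1.1)] -/
theorem tendsto_charFun_localObservable {ι : Type*} (hd : 2 ≤ d) (hq : 1 ≤ q) (hp0 : 0 ≤ p)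
    (hpc : p < rcCriticalProb d q) (b : Bool) {k : ℕ} {F : Finset (Sym2 (Site d))}
    (hF : F ⊆ edgesIn (zdGraph d) (box d k)) (A : Finset ι) (c : ι → ℝ) {E : ι → Set (BondConfig (Site d))}
    (hE : ∀ a ∈ A, DeterminedBy (E a) ↑F) (s : ℝ) :
    Tendsto (fun n : ℕ => ∫ ω, cexp ((((s / Real.sqrt #(box d n)) *
        (∑ z ∈ box d n, ∑ a ∈ A, c a * (E a).indicator (1 : BondConfig (Site d) → ℝ)
            (BondConfig.relabel (sym2Equiv (Site.shift (-z))) ω) -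
          ∫ ω', ∑ z ∈ box d n, ∑ a ∈ A, c a * (E a).indicator (1 : BondConfig (Site d) → ℝ)
            (BondConfig.relabel (sym2Equiv (Site.shift (-z))) ω') ∂(rcLimit d b p q)) : ℝ) : ℂ) * I) ∂(rcLimit d b p q))
      atTop (𝓝 ((Real.exp (-((∑' z : Site d, cov[fun ω => ∑ a ∈ A, c a * (E a).indicator (1 : BondConfig (Site d) → ℝ) ω,
        fun ω => ∑ a ∈ A, c a * (E a).indicator (1 : BondConfig (Site d) → ℝ)
          (BondConfig.relabel (sym2Equiv (Site.shift (-z))) ω); rcLimit d b p q]) * s ^ 2 / 2)) : ℝ) : ℂ)) := by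
  have hp : p ∈ Set.Icc (0 : ℝ) 1 := ⟨hp0, (hpc.trans (rcCriticalProb_lt_one hd hq)).le⟩
  haveI := isProbabilityMeasure_rcLimit (d := d) b p q
  have hμ : IsPositivelyAssociated (rcLimit d b p q) := isPositivelyAssociated_rcLimit b hp hq
  have hEm : ∀ a ∈ A, MeasurableSet (E a) := fun a ha => measurableSet_of_isLocalEvent_holds ⟨F, hE a ha⟩
  -- the observable `f`, measurable and bounded by `C = Σ|c_a|`
  have hfm : Measurable fun ω : BondConfig (Site d) => ∑ a ∈ A, c a * (E a).indicator (1 : BondConfig (Site d) → ℝ) ω :=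
    Finset.measurable_sum _ fun a ha => (measurable_const.indicator (hEm a ha)).const_mul _
  have hfb : ∀ ω : BondConfig (Site d), |∑ a ∈ A, c a * (E a).indicator (1 : BondConfig (Site d) → ℝ) ω| ≤ ∑ a ∈ A, |c a| :=
    fun ω => (Finset.abs_sum_le_sum_abs _ _).trans (Finset.sum_le_sum fun a _ => by
      rw [abs_mul]; exact (mul_le_mul_of_nonneg_left (abs_indicator_one_le_one _ _) (abs_nonneg _)).trans_eq (mul_one _))
  -- the dominator `C · N_F`, measurable and bounded by `C · #F`
  have hedge : ∀ e : Sym2 (Site d), Measurable fun ω : BondConfig (Site d) =>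
      ({ω' : BondConfig (Site d) | e ∈ ω'}).indicator (1 : BondConfig (Site d) → ℝ) ω := fun e =>
    measurable_const.indicator (measurableSet_of_isLocalEvent_holds (isLocalEvent_setOf_mem _))
  have hNm : Measurable fun ω : BondConfig (Site d) => (∑ a ∈ A, |c a|) *
      ∑ e ∈ F, ({ω' : BondConfig (Site d) | e ∈ ω'}).indicator (1 : BondConfig (Site d) → ℝ) ω :=
    (Finset.measurable_sum _ fun e _ => hedge e).const_mul _
  have hNb : ∀ ω : BondConfig (Site d), |(∑ a ∈ A, |c a|) *
      ∑ e ∈ F, ({ω' : BondConfig (Site d) | e ∈ ω'}).indicator (1 : BondConfig (Site d) → ℝ) ω| ≤ (∑ a ∈ A, |c a|) * #F := by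
    intro ω
    rw [abs_mul, abs_of_nonneg (Finset.sum_nonneg fun a _ => abs_nonneg _)]
    refine mul_le_mul_of_nonneg_left ?_ (Finset.sum_nonneg fun a _ => abs_nonneg _)
    refine (Finset.abs_sum_le_sum_abs _ _).trans ?_
    calc ∑ e ∈ F, |({ω' : BondConfig (Site d) | e ∈ ω'}).indicator (1 : BondConfig (Site d) → ℝ) ω|
        ≤ ∑ _e ∈ F, (1 : ℝ) := Finset.sum_le_sum fun e _ => abs_indicator_one_le_one _ _
      _ = #F := by simp
  -- the translation operators are measurable
  have hT : ∀ z : Site d, Measurable (BondConfig.relabel (sym2Equiv (Site.shift (-z))) :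
      BondConfig (Site d) → BondConfig (Site d)) := fun z => (BondConfig.relabel _).measurable
  -- covariance decay constants
  obtain ⟨cst, hcst, hpair⟩ := exists_abs_cov_indicator_shift_le hd hq hp0 hpc hF
  have hsumexp := (summable_exp_neg_mul_siteRad (d := d) hcst).mul_left
    ((∑ a ∈ A, |c a|) * (∑ a ∈ A, |c a|) * (4 * (#F + 1) * Real.exp (cst * (2 * k + 1))))
  have hsumexp' := (summable_exp_neg_mul_siteRad (d := d) hcst).mul_left
    ((∑ e ∈ F, |(∑ a ∈ A, |c a|)|) * (∑ e ∈ F, |(∑ a ∈ A, |c a|)|) * (4 * (#F + 1) * Real.exp (cst * (2 * k + 1))))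
  have hdetEdge : ∀ e ∈ F, DeterminedBy {ω : BondConfig (Site d) | e ∈ ω} ↑F := fun e he => by
    rw [determinedBy_iff]; intro ω₁ ω₂ hω
    have := Set.ext_iff.1 hω e
    simp only [Set.mem_inter_iff, Finset.mem_coe, he, and_true] at this
    exact this
  refine tendsto_charFun_boxSum_of_dominated (μ := rcLimit d b p q)
    (X := fun z ω => ∑ a ∈ A, c a * (E a).indicator (1 : BondConfig (Site d) → ℝ)
      (BondConfig.relabel (sym2Equiv (Site.shift (-z))) ω))
    (Xd := fun z ω => (∑ a ∈ A, |c a|) * ∑ e ∈ F, ({ω' : BondConfig (Site d) | e ∈ ω'}).indicator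
      (1 : BondConfig (Site d) → ℝ) (BondConfig.relabel (sym2Equiv (Site.shift (-z))) ω))
    (γ := fun z => cov[fun ω => ∑ a ∈ A, c a * (E a).indicator (1 : BondConfig (Site d) → ℝ) ω,
      fun ω => ∑ a ∈ A, c a * (E a).indicator (1 : BondConfig (Site d) → ℝ)
        (BondConfig.relabel (sym2Equiv (Site.shift (-z))) ω); rcLimit d b p q])
    (γd := fun z => cov[fun ω => (∑ a ∈ A, |c a|) * ∑ e ∈ F, ({ω' : BondConfig (Site d) | e ∈ ω'}).indicator
        (1 : BondConfig (Site d) → ℝ) ω,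
      fun ω => (∑ a ∈ A, |c a|) * ∑ e ∈ F, ({ω' : BondConfig (Site d) | e ∈ ω'}).indicator
        (1 : BondConfig (Site d) → ℝ) (BondConfig.relabel (sym2Equiv (Site.shift (-z))) ω); rcLimit d b p q])
    (le_trans one_le_two hd) hμ (fun z => hfm.comp (hT z)) (Finset.sum_nonneg fun a _ => abs_nonneg _)
    (fun z ω => hfb _) (fun x y => covariance_comp_shift_eq b hp hq hfm hfm x y) ?_ (fun z => hNm.comp (hT z))
    (fun z ω => hNb _) (fun x y => covariance_comp_shift_eq b hp hq hNm hNm x y) ?_ ?_ s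
  · -- (D) for `f`
    refine Summable.of_norm_bounded hsumexp fun z => ?_
    rw [Real.norm_eq_abs]
    refine (abs_cov_combination_shift_le (rcLimit d b p q) A A c c hEm hEm z
      (fun a ha a' ha' => hpair b (hE a ha) (hE a' ha') z)).trans (le_of_eq ?_)
    ring
  · -- (D) for the dominator
    refine Summable.of_norm_bounded hsumexp' fun z => ?_
    rw [Real.norm_eq_abs]
    have h := abs_cov_combination_shift_le (rcLimit d b p q) F F (fun _ => ∑ a ∈ A, |c a|) (fun _ => ∑ a ∈ A, |c a|)
      (E := fun e => {ω : BondConfig (Site d) | e ∈ ω}) (E' := fun e => {ω : BondConfig (Site d) | e ∈ ω})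
      (fun e _ => measurableSet_of_isLocalEvent_holds (isLocalEvent_setOf_mem _))
      (fun e _ => measurableSet_of_isLocalEvent_holds (isLocalEvent_setOf_mem _)) z
      (fun e he e' he' => hpair b (hdetEdge e he) (hdetEdge e' he') z)
    simp only [← Finset.mul_sum] at h
    refine h.trans (le_of_eq ?_)
    ring
  · -- domination
    intro z ω ω' hle
    have hle' := BondConfig.relabel_mono (sym2Equiv (Site.shift (-z))) hle
    rw [← Finset.sum_sub_distrib, ← mul_sub]
    refine (Finset.abs_sum_le_sum_abs _ _).trans ?_
    rw [Finset.sum_mul]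
    refine Finset.sum_le_sum fun a ha => ?_
    rw [← mul_sub, abs_mul]
    exact mul_le_mul_of_nonneg_left (abs_indicator_sub_le_openCount_sub (hE a ha) hle') (abs_nonneg _)


/-! ### Covariance matrix of finitely many local observables -/
/-- **Summable cross covariances**: for two local observables `f = Σ_a c_a 1_{E_a}`, `f' = Σ_a c'_a 1_{E_a}` over events
determined by `F ⊆ E(Λ_k)` and `0 ≤ p < p_c(q)`: `z ↦ Cov_{φ^b}(f, f' ∘ T_z)` is summable. [cite: Alexander1998, (1.1); Newman1980, Thm. 2 (D)] -/
theorem summable_cov_localObservables {ι : Type*} (hd : 2 ≤ d) (hq : 1 ≤ q) (hp0 : 0 ≤ p) (hpc : p < rcCriticalProb d q)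
    (b : Bool) {k : ℕ} {F : Finset (Sym2 (Site d))} (hF : F ⊆ edgesIn (zdGraph d) (box d k)) (A : Finset ι) (c c' : ι → ℝ)
    {E : ι → Set (BondConfig (Site d))} (hE : ∀ a ∈ A, DeterminedBy (E a) ↑F) :
    Summable fun z : Site d => cov[fun ω => ∑ a ∈ A, c a * (E a).indicator (1 : BondConfig (Site d) → ℝ) ω,
      fun ω => ∑ a ∈ A, c' a * (E a).indicator (1 : BondConfig (Site d) → ℝ)
        (BondConfig.relabel (sym2Equiv (Site.shift (-z))) ω); rcLimit d b p q] := by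
  haveI := isProbabilityMeasure_rcLimit (d := d) b p q
  have hEm : ∀ a ∈ A, MeasurableSet (E a) := fun a ha => measurableSet_of_isLocalEvent_holds ⟨F, hE a ha⟩
  obtain ⟨cst, hcst, hpair⟩ := exists_abs_cov_indicator_shift_le hd hq hp0 hpc hF
  refine Summable.of_norm_bounded ((summable_exp_neg_mul_siteRad (d := d) hcst).mul_left
    ((∑ a ∈ A, |c a|) * (∑ a ∈ A, |c' a|) * (4 * (#F + 1) * Real.exp (cst * (2 * k + 1))))) fun z => ?_
  rw [Real.norm_eq_abs]
  refine (abs_cov_combination_shift_le (rcLimit d b p q) A A c c' hEm hEm z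
    (fun a ha a' ha' => hpair b (hE a ha) (hE a' ha') z)).trans (le_of_eq ?_)
  ring

/-- **Bilinearity along a linear combination**: for `g_t = Σ_i t_i f_i` (written over the common events as
`Σ_a (Σ_i t_i c_{i,a}) 1_{E_a}`), `Cov(g_t, g_t ∘ T_z) = Σ_{i,j} t_i t_j Cov(f_i, f_j ∘ T_z)`. [folklore] -/
theorem cov_linComb_shift_eq {κ ι : Type*} [Fintype κ] (P : Measure (BondConfig (Site d))) [IsProbabilityMeasure P]
    (A : Finset ι) (c : κ → ι → ℝ) {E : ι → Set (BondConfig (Site d))} (hEm : ∀ a ∈ A, MeasurableSet (E a))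
    (t : κ → ℝ) (z : Site d) :
    cov[fun ω => ∑ a ∈ A, (∑ i, t i * c i a) * (E a).indicator (1 : BondConfig (Site d) → ℝ) ω,
      fun ω => ∑ a ∈ A, (∑ i, t i * c i a) * (E a).indicator (1 : BondConfig (Site d) → ℝ)
        (BondConfig.relabel (sym2Equiv (Site.shift (-z))) ω); P] =
    ∑ i, ∑ j, t i * t j * cov[fun ω => ∑ a ∈ A, c i a * (E a).indicator (1 : BondConfig (Site d) → ℝ) ω,
      fun ω => ∑ a ∈ A, c j a * (E a).indicator (1 : BondConfig (Site d) → ℝ)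
        (BondConfig.relabel (sym2Equiv (Site.shift (-z))) ω); P] := by
  have hlin : ∀ η : BondConfig (Site d), ∑ a ∈ A, (∑ i, t i * c i a) * (E a).indicator (1 : BondConfig (Site d) → ℝ) η =
      ∑ i, t i * ∑ a ∈ A, c i a * (E a).indicator (1 : BondConfig (Site d) → ℝ) η := by
    intro η
    simp_rw [Finset.sum_mul, Finset.mul_sum]
    rw [Finset.sum_comm]
    simp_rw [mul_assoc]
  have h1 : (fun ω => ∑ a ∈ A, (∑ i, t i * c i a) * (E a).indicator (1 : BondConfig (Site d) → ℝ) ω) =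
      fun ω => ∑ i, t i * ∑ a ∈ A, c i a * (E a).indicator (1 : BondConfig (Site d) → ℝ) ω := funext fun ω => hlin ω
  have h2 : (fun ω => ∑ a ∈ A, (∑ i, t i * c i a) * (E a).indicator (1 : BondConfig (Site d) → ℝ)
      (BondConfig.relabel (sym2Equiv (Site.shift (-z))) ω)) =
      fun ω => ∑ i, t i * ∑ a ∈ A, c i a * (E a).indicator (1 : BondConfig (Site d) → ℝ)
        (BondConfig.relabel (sym2Equiv (Site.shift (-z))) ω) := funext fun ω => hlin _
  have hfm : ∀ i, Measurable fun ω : BondConfig (Site d) => ∑ a ∈ A, c i a * (E a).indicator (1 : BondConfig (Site d) → ℝ) ω :=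
    fun i => Finset.measurable_sum _ fun a ha => (measurable_const.indicator (hEm a ha)).const_mul _
  have hfb : ∀ i (ω : BondConfig (Site d)), |∑ a ∈ A, c i a * (E a).indicator (1 : BondConfig (Site d) → ℝ) ω| ≤ ∑ a ∈ A, |c i a| :=
    fun i ω => (Finset.abs_sum_le_sum_abs _ _).trans (Finset.sum_le_sum fun a _ => by
      rw [abs_mul]; exact (mul_le_mul_of_nonneg_left (abs_indicator_one_le_one _ _) (abs_nonneg _)).trans_eq (mul_one _))
  have hT : Measurable (BondConfig.relabel (sym2Equiv (Site.shift (-z))) : BondConfig (Site d) → BondConfig (Site d)) :=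
    (BondConfig.relabel _).measurable
  have hm1 : ∀ i ∈ (Finset.univ : Finset κ), MemLp (fun ω => t i * ∑ a ∈ A, c i a * (E a).indicator (1 : BondConfig (Site d) → ℝ) ω) 2 P :=
    fun i _ => (memLp_of_abs_le (hfm i) (hfb i) 2).const_mul _
  have hm2 : ∀ j ∈ (Finset.univ : Finset κ), MemLp (fun ω => t j * ∑ a ∈ A, c j a * (E a).indicator (1 : BondConfig (Site d) → ℝ)
      (BondConfig.relabel (sym2Equiv (Site.shift (-z))) ω)) 2 P :=
    fun j _ => (memLp_of_abs_le ((hfm j).comp hT) (fun ω => hfb j _) 2).const_mul _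
  rw [h1, h2, covariance_fun_sum_fun_sum' hm1 hm2]
  refine Finset.sum_congr rfl fun i _ => Finset.sum_congr rfl fun j _ => ?_
  rw [covariance_const_mul_left, covariance_const_mul_right, mul_assoc]

/-- **The quadratic form of the covariance matrix**: with `Σ_{ij} = Σ_z Cov(f_i, f_j ∘ T_z)`,
`t ⬝ Σ t = Σ_z Cov(g_t, g_t ∘ T_z)`, `g_t = Σ_i t_i f_i`. [cite: Newman1980, Thm. 2 (D)] -/
theorem dotProduct_localCovMatrix_mulVec_eq {κ ι : Type*} [Fintype κ] (hd : 2 ≤ d) (hq : 1 ≤ q) (hp0 : 0 ≤ p)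
    (hpc : p < rcCriticalProb d q) (b : Bool) {k : ℕ} {F : Finset (Sym2 (Site d))} (hF : F ⊆ edgesIn (zdGraph d) (box d k))
    (A : Finset ι) (c : κ → ι → ℝ) {E : ι → Set (BondConfig (Site d))} (hE : ∀ a ∈ A, DeterminedBy (E a) ↑F)
    {S : Matrix κ κ ℝ}
    (hS : ∀ i j, S i j = ∑' z : Site d, cov[fun ω => ∑ a ∈ A, c i a * (E a).indicator (1 : BondConfig (Site d) → ℝ) ω,
      fun ω => ∑ a ∈ A, c j a * (E a).indicator (1 : BondConfig (Site d) → ℝ)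
        (BondConfig.relabel (sym2Equiv (Site.shift (-z))) ω); rcLimit d b p q]) (t : κ → ℝ) :
    t ⬝ᵥ S *ᵥ t = ∑' z : Site d, cov[fun ω => ∑ a ∈ A, (∑ i, t i * c i a) * (E a).indicator (1 : BondConfig (Site d) → ℝ) ω,
      fun ω => ∑ a ∈ A, (∑ i, t i * c i a) * (E a).indicator (1 : BondConfig (Site d) → ℝ)
        (BondConfig.relabel (sym2Equiv (Site.shift (-z))) ω); rcLimit d b p q] := by
  haveI := isProbabilityMeasure_rcLimit (d := d) b p q
  have hEm : ∀ a ∈ A, MeasurableSet (E a) := fun a ha => measurableSet_of_isLocalEvent_holds ⟨F, hE a ha⟩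
  have hsum : ∀ i j, Summable fun z : Site d => cov[fun ω => ∑ a ∈ A, c i a * (E a).indicator (1 : BondConfig (Site d) → ℝ) ω,
      fun ω => ∑ a ∈ A, c j a * (E a).indicator (1 : BondConfig (Site d) → ℝ)
        (BondConfig.relabel (sym2Equiv (Site.shift (-z))) ω); rcLimit d b p q] :=
    fun i j => summable_cov_localObservables hd hq hp0 hpc b hF A (c i) (c j) hE
  simp_rw [cov_linComb_shift_eq (rcLimit d b p q) A c hEm t]
  rw [Summable.tsum_finsetSum (fun i _ => summable_sum fun j _ => (hsum i j).mul_left _)]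
  simp_rw [Summable.tsum_finsetSum (fun j _ => (hsum _ j).mul_left _), (hsum _ _).tsum_mul_left, ← hS]
  simp only [dotProduct, Matrix.mulVec, Finset.mul_sum]
  refine Finset.sum_congr rfl fun i _ => Finset.sum_congr rfl fun j _ => ?_
  ring

/-- **The covariance matrix `Σ_{ij} = Σ_z Cov_{φ^b}(f_i, f_j ∘ T_z)` is positive semidefinite** (symmetric by translation
invariance — `Cov(f_j, f_i ∘ T_z) = Cov(f_i, f_j ∘ T_{−z})` — and `t ⬝ Σ t = lim_n Var(S_n(g_t))/|Λ_n| ≥ 0`).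
[cite: Newman1980, Thm. 2 (D); Grimmett2006, Thm. (4.19)(b)] -/
theorem posSemidef_localCovMatrix {κ ι : Type*} [Fintype κ] (hd : 2 ≤ d) (hq : 1 ≤ q) (hp0 : 0 ≤ p)
    (hpc : p < rcCriticalProb d q) (b : Bool) {k : ℕ} {F : Finset (Sym2 (Site d))} (hF : F ⊆ edgesIn (zdGraph d) (box d k))
    (A : Finset ι) (c : κ → ι → ℝ) {E : ι → Set (BondConfig (Site d))} (hE : ∀ a ∈ A, DeterminedBy (E a) ↑F)
    {S : Matrix κ κ ℝ}
    (hS : ∀ i j, S i j = ∑' z : Site d, cov[fun ω => ∑ a ∈ A, c i a * (E a).indicator (1 : BondConfig (Site d) → ℝ) ω,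
      fun ω => ∑ a ∈ A, c j a * (E a).indicator (1 : BondConfig (Site d) → ℝ)
        (BondConfig.relabel (sym2Equiv (Site.shift (-z))) ω); rcLimit d b p q]) :
    S.PosSemidef := by
  have hp : p ∈ Set.Icc (0 : ℝ) 1 := ⟨hp0, (hpc.trans (rcCriticalProb_lt_one hd hq)).le⟩
  haveI := isProbabilityMeasure_rcLimit (d := d) b p q
  have hEm : ∀ a ∈ A, MeasurableSet (E a) := fun a ha => measurableSet_of_isLocalEvent_holds ⟨F, hE a ha⟩
  have hfm : ∀ (e : ι → ℝ), Measurable fun ω : BondConfig (Site d) => ∑ a ∈ A, e a * (E a).indicator (1 : BondConfig (Site d) → ℝ) ω :=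
    fun e => Finset.measurable_sum _ fun a ha => (measurable_const.indicator (hEm a ha)).const_mul _
  have hfb : ∀ (e : ι → ℝ) (ω : BondConfig (Site d)), |∑ a ∈ A, e a * (E a).indicator (1 : BondConfig (Site d) → ℝ) ω| ≤ ∑ a ∈ A, |e a| :=
    fun e ω => (Finset.abs_sum_le_sum_abs _ _).trans (Finset.sum_le_sum fun a _ => by
      rw [abs_mul]; exact (mul_le_mul_of_nonneg_left (abs_indicator_one_le_one _ _) (abs_nonneg _)).trans_eq (mul_one _))
  have hT : ∀ z : Site d, Measurable (BondConfig.relabel (sym2Equiv (Site.shift (-z))) :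
      BondConfig (Site d) → BondConfig (Site d)) := fun z => (BondConfig.relabel _).measurable
  -- `T_0 = id`
  have hT0 : ∀ ω : BondConfig (Site d), BondConfig.relabel (sym2Equiv (Site.shift (-(0 : Site d)))) ω = ω := by
    intro ω
    rw [neg_zero]
    ext z
    rw [BondConfig.mem_relabel_iff, sym2Equiv_symm, sym2Equiv_apply]
    have h : ((Site.shift (0 : Site d)).symm : Site d → Site d) = id :=
      funext fun x => by rw [Site.shift_symm_apply, sub_zero]; rfl
    rw [h, Sym2.map_id, id]
  refine Matrix.PosSemidef.of_dotProduct_mulVec_nonneg ?_ fun t => ?_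
  · -- symmetry
    refine Matrix.IsHermitian.ext fun i j => ?_
    rw [star_trivial, hS, hS]
    symm
    rw [← (Equiv.neg (Site d)).tsum_eq]
    refine tsum_congr fun z => ?_
    rw [Equiv.neg_apply]
    conv_rhs => rw [covariance_comm]
    have h := covariance_comp_shift_eq b hp hq (hfm (c i)) (hfm (c j)) z 0
    simp only [hT0, zero_sub] at h
    exact h.symm
  · -- nonnegativity of the quadratic form
    rw [star_trivial, dotProduct_localCovMatrix_mulVec_eq hd hq hp0 hpc b hF A c hE hS t]
    have hsum := summable_cov_localObservables hd hq hp0 hpc b hF A (fun a => ∑ i, t i * c i a) (fun a => ∑ i, t i * c i a) hE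
    obtain ⟨γt, hγt⟩ : ∃ γt : Site d → ℝ, ∀ w, γt w = cov[fun ω => ∑ a ∈ A, (∑ i, t i * c i a) *
        (E a).indicator (1 : BondConfig (Site d) → ℝ) ω, fun ω => ∑ a ∈ A, (∑ i, t i * c i a) *
          (E a).indicator (1 : BondConfig (Site d) → ℝ) (BondConfig.relabel (sym2Equiv (Site.shift (-w))) ω); rcLimit d b p q] :=
      ⟨_, fun w => rfl⟩
    have hcov : ∀ x y : Site d, cov[fun ω => ∑ a ∈ A, (∑ i, t i * c i a) * (E a).indicator (1 : BondConfig (Site d) → ℝ)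
        (BondConfig.relabel (sym2Equiv (Site.shift (-x))) ω),
        fun ω => ∑ a ∈ A, (∑ i, t i * c i a) * (E a).indicator (1 : BondConfig (Site d) → ℝ)
          (BondConfig.relabel (sym2Equiv (Site.shift (-y))) ω); rcLimit d b p q] = γt (y - x) :=
      fun x y => (covariance_comp_shift_eq b hp hq (hfm _) (hfm _) x y).trans (hγt _).symm
    have hsum' : Summable γt := hsum.congr fun w => (hγt w).symm
    have hXm : ∀ z : Site d, Measurable fun ω : BondConfig (Site d) => ∑ a ∈ A, (∑ i, t i * c i a) *
        (E a).indicator (1 : BondConfig (Site d) → ℝ) (BondConfig.relabel (sym2Equiv (Site.shift (-z))) ω) :=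
      fun z => (hfm _).comp (hT z)
    have hXb : ∀ (z : Site d) (ω : BondConfig (Site d)), |∑ a ∈ A, (∑ i, t i * c i a) *
        (E a).indicator (1 : BondConfig (Site d) → ℝ) (BondConfig.relabel (sym2Equiv (Site.shift (-z))) ω)| ≤
        ∑ a ∈ A, |∑ i, t i * c i a| := fun z ω => hfb _ _
    rw [tsum_congr fun z => (hγt z).symm]
    exact ge_of_tendsto' (tendsto_sum_sum_box_div_card_of_summable γt hsum') fun L =>
      div_nonneg (sum_sum_kernel_self_nonneg hXm hXb hcov (box d L)) (Nat.cast_nonneg _)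


/-! ### The joint central limit theorem -/
/-- **JOINT CENTRAL LIMIT THEOREM FOR ∑ a ∈ A, c i a * (E a).indicator (1 : BondConfig (Site d) → ℝ)NITELY MANY LOCAL OBSERVABLES BELOW `p_c(q)`** (`d ≥ 2`, `q ≥ 1`,
`0 ≤ p < p_c(q)`, both `b`). Let `f_i = Σ_{a∈A} c_{i,a} 1_{E_a}` (`i ∈ κ`, `κ` finite) be local observables over events
`E_a` determined by `F ⊆ E(Λ_k)`, and `Σ_{ij} = Σ_z Cov_{φ^b}(f_i, f_j ∘ T_z)` (absolutely convergent; `Σ` is positive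
semidefinite by `posSemidef_localCovMatrix`). Then the random VECTOR
`V_n = |Λ_n|^{-1/2} (S_n(f_i) − E S_n(f_i))_{i∈κ}`, `S_n(f) = Σ_{z∈Λ_n} f ∘ T_z`, converges in distribution under
`φ^b_{p,q}` to the centred Gaussian vector `N(0, Σ)` on `ℝ^κ` (`multivariateGaussian 0 Σ` on `EuclideanSpace ℝ κ`).
Proof: Cramér–Wold through the finite-dimensional Lévy continuity theorem — for `t ∈ ℝ^κ`,
`⟨V_n, t⟩ = |Λ_n|^{-1/2}(S_n(g_t) − E S_n(g_t))` with the local observable `g_t = Σ_i t_i f_i`, whose characteristic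
function at `1` converges to `exp(−σ²(g_t)/2)` (`tendsto_charFun_localObservable`), and `σ²(g_t) = t ⬝ Σ t`
(`dotProduct_localCovMatrix_mulVec_eq`) — which is the characteristic function of `N(0, Σ)` at `t`.
[cite: Newman1980, Thm. 2; Alexander1998, (1.1); Grimmett2006, Thm. (4.19)(b)] -/
theorem tendstoInDistribution_localObservables_joint {Ω' : Type*} {mΩ' : MeasurableSpace Ω'} {P' : Measure Ω'}
    [IsProbabilityMeasure P'] {κ : Type*} [Fintype κ] [DecidableEq κ] {Z : Ω' → EuclideanSpace ℝ κ} {ι : Type*}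
    (hd : 2 ≤ d) (hq : 1 ≤ q) (hp0 : 0 ≤ p) (hpc : p < rcCriticalProb d q) (b : Bool) {k : ℕ}
    {F : Finset (Sym2 (Site d))} (hF : F ⊆ edgesIn (zdGraph d) (box d k)) (A : Finset ι) (c : κ → ι → ℝ)
    {E : ι → Set (BondConfig (Site d))} (hE : ∀ a ∈ A, DeterminedBy (E a) ↑F) {S : Matrix κ κ ℝ}
    (hS : ∀ i j, S i j = ∑' z : Site d, cov[fun ω => ∑ a ∈ A, c i a * (E a).indicator (1 : BondConfig (Site d) → ℝ) ω,
      fun ω => ∑ a ∈ A, c j a * (E a).indicator (1 : BondConfig (Site d) → ℝ)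
        (BondConfig.relabel (sym2Equiv (Site.shift (-z))) ω); rcLimit d b p q])
    (hZ : HasLaw Z (multivariateGaussian 0 S) P') :
    haveI := isProbabilityMeasure_rcLimit (d := d) b p q
    TendstoInDistribution (fun (n : ℕ) (ω : BondConfig (Site d)) =>
        (WithLp.toLp 2 fun i : κ => (Real.sqrt #(box d n))⁻¹ *
          (∑ z ∈ box d n, ∑ a ∈ A, c i a * (E a).indicator (1 : BondConfig (Site d) → ℝ) (BondConfig.relabel (sym2Equiv (Site.shift (-z))) ω) -
            ∫ ω', ∑ z ∈ box d n, ∑ a ∈ A, c i a * (E a).indicator (1 : BondConfig (Site d) → ℝ) (BondConfig.relabel (sym2Equiv (Site.shift (-z))) ω') ∂(rcLimit d b p q)) :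
          EuclideanSpace ℝ κ))
      atTop Z (fun _ => rcLimit d b p q) P' := by
  haveI := isProbabilityMeasure_rcLimit (d := d) b p q
  have hEm : ∀ a ∈ A, MeasurableSet (E a) := fun a ha => measurableSet_of_isLocalEvent_holds ⟨F, hE a ha⟩
  have hfm : ∀ (e : ι → ℝ), Measurable fun ω : BondConfig (Site d) =>
      ∑ a ∈ A, e a * (E a).indicator (1 : BondConfig (Site d) → ℝ) ω :=
    fun e => Finset.measurable_sum _ fun a ha => (measurable_const.indicator (hEm a ha)).const_mul _
  have hfb : ∀ (e : ι → ℝ) (ω : BondConfig (Site d)),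
      |∑ a ∈ A, e a * (E a).indicator (1 : BondConfig (Site d) → ℝ) ω| ≤ ∑ a ∈ A, |e a| :=
    fun e ω => (Finset.abs_sum_le_sum_abs _ _).trans (Finset.sum_le_sum fun a _ => by
      rw [abs_mul]; exact (mul_le_mul_of_nonneg_left (abs_indicator_one_le_one _ _) (abs_nonneg _)).trans_eq (mul_one _))
  have hT : ∀ z : Site d, Measurable (BondConfig.relabel (sym2Equiv (Site.shift (-z))) :
      BondConfig (Site d) → BondConfig (Site d)) := fun z => (BondConfig.relabel _).measurable
  have hSm : ∀ (e : ι → ℝ) (n : ℕ), Measurable fun ω : BondConfig (Site d) => ∑ z ∈ box d n,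
      ∑ a ∈ A, e a * (E a).indicator (1 : BondConfig (Site d) → ℝ) (BondConfig.relabel (sym2Equiv (Site.shift (-z))) ω) :=
    fun e n => Finset.measurable_sum _ fun z _ => (hfm e).comp (hT z)
  have hSint : ∀ (e : ι → ℝ) (n : ℕ), Integrable (fun ω : BondConfig (Site d) => ∑ z ∈ box d n,
      ∑ a ∈ A, e a * (E a).indicator (1 : BondConfig (Site d) → ℝ) (BondConfig.relabel (sym2Equiv (Site.shift (-z))) ω))
      (rcLimit d b p q) :=
    fun e n => memLp_one_iff_integrable.1 (memLp_of_abs_le (hSm e n)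
      (fun ω => (Finset.abs_sum_le_sum_abs _ _).trans (Finset.sum_le_sum fun z _ => hfb e _)) 1)
  have hVm : ∀ n : ℕ, Measurable fun ω : BondConfig (Site d) =>
      (WithLp.toLp 2 fun i : κ => (Real.sqrt #(box d n))⁻¹ *
        (∑ z ∈ box d n, ∑ a ∈ A, c i a * (E a).indicator (1 : BondConfig (Site d) → ℝ) (BondConfig.relabel (sym2Equiv (Site.shift (-z))) ω) -
          ∫ ω', ∑ z ∈ box d n, ∑ a ∈ A, c i a * (E a).indicator (1 : BondConfig (Site d) → ℝ) (BondConfig.relabel (sym2Equiv (Site.shift (-z))) ω') ∂(rcLimit d b p q)) :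
        EuclideanSpace ℝ κ) :=
    fun n => (WithLp.measurable_toLp (p := 2) (X := κ → ℝ)).comp
      (measurable_pi_lambda _ fun i => ((hSm (c i) n).sub_const _).const_mul _)
  refine ⟨fun n => (hVm n).aemeasurable, hZ.aemeasurable, ?_⟩
  refine ProbabilityMeasure.tendsto_iff_tendsto_charFun.2 fun t => ?_
  rw! [hZ.map_eq]
  simp only [ProbabilityMeasure.coe_mk]
  -- the linear combination `g_t = Σ_i t_i f_i`, written over the common events
  have hlin : ∀ η : BondConfig (Site d), ∑ a ∈ A, (∑ i, t.ofLp i * c i a) * (E a).indicator (1 : BondConfig (Site d) → ℝ) η =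
      ∑ i, t.ofLp i * ∑ a ∈ A, c i a * (E a).indicator (1 : BondConfig (Site d) → ℝ) η := by
    intro η
    simp_rw [Finset.sum_mul, Finset.mul_sum]
    rw [Finset.sum_comm]
    simp_rw [mul_assoc]
  have hσ : t.ofLp ⬝ᵥ S *ᵥ t.ofLp = ∑' z : Site d, cov[fun ω => ∑ a ∈ A, (∑ i, t.ofLp i * c i a) *
      (E a).indicator (1 : BondConfig (Site d) → ℝ) ω, fun ω => ∑ a ∈ A, (∑ i, t.ofLp i * c i a) *
        (E a).indicator (1 : BondConfig (Site d) → ℝ) (BondConfig.relabel (sym2Equiv (Site.shift (-z))) ω); rcLimit d b p q] :=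
    dotProduct_localCovMatrix_mulVec_eq hd hq hp0 hpc b hF A c hE hS t.ofLp
  rw [charFun_multivariateGaussian (posSemidef_localCovMatrix hd hq hp0 hpc b hF A c hE hS), inner_zero_right, hσ,
    Complex.ofReal_zero, show ∀ σ : ℝ, cexp (0 * I - (σ : ℂ) / 2) = ((Real.exp (-(σ * (1 : ℝ) ^ 2 / 2)) : ℝ) : ℂ) from fun σ => by
      rw [Complex.ofReal_exp]; congr 1; push_cast; ring]
  have key := tendsto_charFun_localObservable hd hq hp0 hpc b hF A (fun a => ∑ i, t.ofLp i * c i a) hE 1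
  refine key.congr fun n => ?_
  -- identify the scalar characteristic function of `⟨V_n, t⟩` with that of `S_n(g_t)`
  have hlinS : ∀ ω : BondConfig (Site d), ∑ z ∈ box d n, ∑ a ∈ A, (∑ i, t.ofLp i * c i a) *
      (E a).indicator (1 : BondConfig (Site d) → ℝ) (BondConfig.relabel (sym2Equiv (Site.shift (-z))) ω) =
      ∑ i, t.ofLp i * ∑ z ∈ box d n, ∑ a ∈ A, c i a * (E a).indicator (1 : BondConfig (Site d) → ℝ) (BondConfig.relabel (sym2Equiv (Site.shift (-z))) ω) := by
    intro ω
    simp_rw [hlin]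
    rw [Finset.sum_comm]
    simp_rw [Finset.mul_sum]
  have hint : ∫ ω', ∑ z ∈ box d n, ∑ a ∈ A, (∑ i, t.ofLp i * c i a) *
      (E a).indicator (1 : BondConfig (Site d) → ℝ) (BondConfig.relabel (sym2Equiv (Site.shift (-z))) ω') ∂(rcLimit d b p q) =
      ∑ i, t.ofLp i * ∫ ω', ∑ z ∈ box d n, ∑ a ∈ A, c i a * (E a).indicator (1 : BondConfig (Site d) → ℝ) (BondConfig.relabel (sym2Equiv (Site.shift (-z))) ω') ∂(rcLimit d b p q) := by
    simp_rw [hlinS]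
    rw [integral_finsetSum _ (fun i _ => (hSint (c i) n).const_mul _)]
    simp_rw [integral_const_mul]
  rw [charFun_apply, integral_map (hVm n).aemeasurable (by fun_prop)]
  refine integral_congr_ae (ae_of_all _ fun ω => ?_)
  simp only [hlinS ω, hint, PiLp.inner_apply, RCLike.inner_apply, conj_trivial]
  congr 1
  push_cast
  rw [← Finset.sum_sub_distrib, Finset.mul_sum]
  exact congrArg (· * I) (Finset.sum_congr rfl fun i _ => by ring)

end NewmanCLT

end Summit.CriticalPhenomena.PercolationContinuityZ3.Theorems.FK
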